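import Mathlib

/-!
# Tier4/Line1/L2Infinite — `L²` of a set of positive measure is infinite-dimensional when singletons are null

Blind re-derivation cell `pub-hodge-repro`, Tier 4 (README §9–§10), seat t4-L1-p5 (prover, LINE L1, gen 0).
Mathlib only.  The `orth` clause of the skeleton's `IsAdaptedONB` is an infinite orthonormal sequence in `L²(DG, μ)`,
so the J1 glue needs `L²(DG, μ)` infinite-dimensional (S12636).  This file proves the general statement: on a second
countable `T1` space, a measure with null singletons (`NullSingletonClass`; Haar measures on non-discrete groups are
such by `IsHaarMeasure.nullSingletonClass`) gives, on every measurable set `A` with `0 < μ A < ∞`, an infinite sequence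
of pairwise disjoint measurable subsets of positive measure (a set of positive measure SPLITS: otherwise every basic
open set or its complement carries the full measure of `A`, and the intersection of the chosen halves is a
subsingleton of positive measure), whose indicators are orthogonal non-zero elements of `Lp ℂ 2 (μ.restrict A)`.

Nothing here says anything about the status of the Hodge conjecture for CM abelian varieties, which is NOT proved
(HC_CM is NOT proved by anyone in this repository).
-/

set_option autoImplicit false

noncomputable section

namespace Summit.Ventures.HodgeRepro.Tier4.Line1

open MeasureTheory Topology TopologicalSpace Set Function
open scoped ENNReal InnerProductSpace

section Split

variable {X : Type*} [TopologicalSpace X] [T1Space X] [SecondCountableTopology X]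
  [MeasurableSpace X] [OpensMeasurableSpace X]

/-- **A set of positive finite measure splits** when singletons are null: it contains a measurable subset whose
measure and whose complement's measure are both positive. -/
theorem exists_measurableSet_pos_pos (μ : Measure X) [NullSingletonClass μ] {A : Set X}
    (hA : MeasurableSet A) (hpos : 0 < μ A) :
    ∃ B : Set X, B ⊆ A ∧ MeasurableSet B ∧ 0 < μ B ∧ 0 < μ (A \ B) := by
  classical
  by_contra hcon
  push Not at hcon
  -- the dichotomy: every measurable subset of `A` has measure `0` or `μ A`
  have hdich : ∀ B : Set X, B ⊆ A → MeasurableSet B → μ B = 0 ∨ μ (A \ B) = 0 := by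
    intro B hBA hB
    by_cases h0 : μ B = 0
    · exact Or.inl h0
    · exact Or.inr (le_antisymm (hcon B hBA hB (pos_iff_ne_zero.2 h0)) bot_le)
  -- for each basic open set choose the half carrying the full measure of `A`
  let C : Set X → Set X := fun U => if μ (A ∩ U) = 0 then Uᶜ else U
  have hCdef : ∀ U, C U = if μ (A ∩ U) = 0 then Uᶜ else U := fun U => rfl
  have hCm : ∀ U ∈ countableBasis X, MeasurableSet (C U) := by
    intro U hU
    have hUm : MeasurableSet U := (isOpen_of_mem_countableBasis hU).measurableSet
    rw [hCdef]
    split_ifs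
    · exact hUm.compl
    · exact hUm
  have hC : ∀ U ∈ countableBasis X, μ (A \ C U) = 0 := by
    intro U hU
    have hUm : MeasurableSet U := (isOpen_of_mem_countableBasis hU).measurableSet
    rw [hCdef]
    by_cases h0 : μ (A ∩ U) = 0
    · rw [if_pos h0, sdiff_compl]
      exact h0
    · rw [if_neg h0]
      rcases hdich (A ∩ U) inter_subset_left (hA.inter hUm) with h | h
      · exact absurd h h0
      · simpa [sdiff_inter_self_eq_sdiff] using h
  -- the intersection of the chosen halves is a subsingleton
  have hsub : (A ∩ ⋂ U ∈ countableBasis X, C U).Subsingleton := by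
    intro x hx y hy
    by_contra hxy
    obtain ⟨V, hVo, hxV, hyV⟩ := t1Space_iff_exists_open.1 ‹T1Space X› hxy
    obtain ⟨U, hU, hxU, hUV⟩ := (isBasis_countableBasis X).exists_subset_of_mem_open hxV hVo
    have hx' : x ∈ C U := mem_iInter₂.1 hx.2 U hU
    have hy' : y ∈ C U := mem_iInter₂.1 hy.2 U hU
    have hyU : y ∉ U := fun h => hyV (hUV h)
    rw [hCdef] at hx' hy'
    by_cases h0 : μ (A ∩ U) = 0
    · rw [if_pos h0] at hx'
      exact hx' hxU
    · rw [if_neg h0] at hy'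
      exact hyU hy'
  -- but it has the full measure of `A`
  have hfull : μ (A \ ⋂ U ∈ countableBasis X, C U) = 0 := by
    have : A \ ⋂ U ∈ countableBasis X, C U = ⋃ U ∈ countableBasis X, (A \ C U) := by
      ext x
      simp only [mem_sdiff, mem_iInter, mem_iUnion, exists_prop, not_forall]
      constructor
      · rintro ⟨hxA, U, hU, hxC⟩
        exact ⟨U, hU, hxA, hxC⟩
      · rintro ⟨U, hU, hxA, hxC⟩
        exact ⟨hxA, U, hU, hxC⟩
    rw [this]
    exact (measure_biUnion_null_iff (countable_countableBasis X)).2 fun U hU => hC U hU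
  have h1 : μ (A ∩ ⋂ U ∈ countableBasis X, C U) = μ A := by
    have := measure_inter_add_sdiff (μ := μ) A
      (MeasurableSet.biInter (countable_countableBasis X) fun U hU => hCm U hU)
    rw [hfull, add_zero] at this
    exact this
  have h2 : μ (A ∩ ⋂ U ∈ countableBasis X, C U) = 0 := hsub.measure_zero μ
  rw [h2] at h1
  exact hpos.ne h1

/-- The splitting iterated: infinitely many pairwise disjoint measurable subsets of positive measure. -/
theorem exists_seq_disjoint_measure_pos (μ : Measure X) [NullSingletonClass μ] {A : Set X}
    (hA : MeasurableSet A) (hpos : 0 < μ A) :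
    ∃ B : ℕ → Set X, (∀ n, MeasurableSet (B n)) ∧ (∀ n, B n ⊆ A) ∧ (∀ n, 0 < μ (B n)) ∧
      Pairwise (Disjoint on B) := by
  classical
  -- the remainders, as a subtype carrying measurability, positivity and finiteness
  let T := {S : Set X // MeasurableSet S ∧ 0 < μ S}
  let split : T → Set X := fun S =>
    Classical.choose (exists_measurableSet_pos_pos μ S.2.1 S.2.2)
  have hsplit : ∀ S : T, split S ⊆ S.1 ∧ MeasurableSet (split S) ∧ 0 < μ (split S) ∧
      0 < μ (S.1 \ split S) := fun S =>
    Classical.choose_spec (exists_measurableSet_pos_pos μ S.2.1 S.2.2)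
  let next : T → T := fun S => ⟨S.1 \ split S, S.2.1.diff (hsplit S).2.1, (hsplit S).2.2.2⟩
  let R : ℕ → T := fun n => Nat.rec (⟨A, hA, hpos⟩ : T) (fun _ S => next S) n
  have hR : ∀ n, R (n + 1) = next (R n) := fun n => rfl
  let B : ℕ → Set X := fun n => split (R n)
  have hBR : ∀ n, B n ⊆ (R n).1 := fun n => (hsplit (R n)).1
  have hRsucc : ∀ n, (R (n + 1)).1 = (R n).1 \ B n := fun n => rfl
  have hRmono : ∀ m n, m ≤ n → (R n).1 ⊆ (R m).1 := by
    intro m n hmn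
    induction hmn with
    | refl => exact subset_rfl
    | step _ ih => exact (hRsucc _ ▸ sdiff_subset).trans ih
  have hRA : ∀ n, (R n).1 ⊆ A := fun n => hRmono 0 n (Nat.zero_le n)
  refine ⟨B, fun n => (hsplit (R n)).2.1, fun n => (hBR n).trans (hRA n),
    fun n => (hsplit (R n)).2.2.1, ?_⟩
  -- disjointness: for `m < n`, `B n ⊆ R n ⊆ R (m + 1) = R m \ B m`
  have key : ∀ m n, m < n → Disjoint (B m) (B n) := by
    intro m n hmn
    have h1 : B n ⊆ (R m).1 \ B m := (hBR n).trans ((hRmono (m + 1) n hmn).trans (hRsucc m).le)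
    exact Disjoint.symm (disjoint_sdiff_left.mono_left h1)
  intro m n hmn
  rcases lt_or_gt_of_ne hmn with h | h
  · exact key m n h
  · exact (key n m h).symm

end Split

section L2

variable {X : Type*} [TopologicalSpace X] [T1Space X] [SecondCountableTopology X]
  [MeasurableSpace X] [OpensMeasurableSpace X]

/-- **`L²(A, μ)` is infinite-dimensional** for a set `A` of positive finite measure and a measure with null
singletons: the indicators of the disjoint pieces of `exists_seq_disjoint_measure_pos` are orthogonal and non-zero. -/
theorem not_finiteDimensional_Lp_two_restrict (μ : Measure X) [NullSingletonClass μ] {A : Set X}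
    (hA : MeasurableSet A) (hpos : 0 < μ A) (hfin : μ A ≠ ∞) :
    ¬ FiniteDimensional ℂ (Lp ℂ 2 (μ.restrict A)) := by
  intro hfd
  obtain ⟨B, hBm, hBA, hBpos, hBdisj⟩ := exists_seq_disjoint_measure_pos μ hA hpos
  have hBfin : ∀ n, (μ.restrict A) (B n) ≠ ∞ := fun n => by
    rw [Measure.restrict_apply (hBm n)]
    exact ne_top_of_le_ne_top hfin (measure_mono inter_subset_right)
  have hBpos' : ∀ n, (μ.restrict A) (B n) ≠ 0 := fun n => by
    rw [Measure.restrict_apply (hBm n), inter_eq_self_of_subset_left (hBA n)]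
    exact (hBpos n).ne'
  let v : ℕ → Lp ℂ 2 (μ.restrict A) := fun n => indicatorConstLp 2 (hBm n) (hBfin n) (1 : ℂ)
  have hreal : ∀ n, 0 < (μ.restrict A).real (B n) := fun n => by
    rw [measureReal_def]
    exact ENNReal.toReal_pos (hBpos' n) (hBfin n)
  have hz : ∀ n, v n ≠ 0 := fun n => by
    rw [← norm_pos_iff]
    show 0 < ‖indicatorConstLp 2 (hBm n) (hBfin n) (1 : ℂ)‖
    rw [norm_indicatorConstLp two_ne_zero ENNReal.ofNat_ne_top]
    exact mul_pos (by simp) (Real.rpow_pos_of_pos (hreal n) _)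
  have ho : Pairwise fun m n => ⟪v m, v n⟫_ℂ = 0 := by
    intro m n hmn
    show ⟪indicatorConstLp 2 (hBm m) (hBfin m) (1 : ℂ), indicatorConstLp 2 (hBm n) (hBfin n) (1 : ℂ)⟫_ℂ = 0
    rw [L2.inner_def]
    refine integral_eq_zero_of_ae ?_
    filter_upwards [indicatorConstLp_coeFn (p := 2) (μ := μ.restrict A) (s := B m) (hs := hBm m)
      (hμs := hBfin m) (c := (1 : ℂ)), indicatorConstLp_coeFn (p := 2) (μ := μ.restrict A)
      (s := B n) (hs := hBm n) (hμs := hBfin n) (c := (1 : ℂ))] with x hxm hxn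
    simp only [Pi.zero_apply]
    rw [hxm, hxn]
    by_cases hx : x ∈ B m
    · have hxn' : x ∉ B n := fun h => (Set.disjoint_left.1 (hBdisj hmn)) hx h
      rw [Set.indicator_of_notMem hxn', inner_zero_right]
    · rw [Set.indicator_of_notMem hx, inner_zero_left]
  have hli : LinearIndependent ℂ v := linearIndependent_of_ne_zero_of_inner_eq_zero hz ho
  exact Module.Finite.not_linearIndependent_of_infinite v hli

end L2

end Summit.Ventures.HodgeRepro.Tier4.Line1

end
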